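import Summits.QuantumFields.BalabanUV.Beta.D1BFx.RWeightedLegPackReadout
import Summits.QuantumFields.BalabanUV.Beta.D1BFx.PackedKernelSplitBounds
import Literature.MathematicalPhysics.QuantumFieldTheory.Balaban1983to89.Beta.StepDriftWitness

/-!
# Road «BF-x» — slot (K), «RK-ABS»: THE NAMED REST KERNELS OF THE N-SIDE ARE WELL-TYPED (1.22)-KERNELS (`AbsMoment₂` of every channel)

`DICT-CHAIN-SPEC.md` §1 (S-N)∕§3 (a).  After «DICT-PTW» (`RoadEndBFxDictPointwiseS`, p306436) the (K) row of road BF-x carries, besides the pointwise dictionary `hptw`, the row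
`hMR : ∀ u m ≥ 1, AbsMoment₂ (Rk u (Lc^m) μ ν)` for the rest kernels; «NLEG-HESS-SPLIT» (`NlegKHessSplit`) names the N-side rest kernels as the SANDWICH CROSS WORDS
`legCross (½•Ga) ((−½)•sandwich_ff) V_ff W_ff` and the BLOCK TERMS `blockTerms (NlegK …) V W` of `PackedKernelSplit`.  This file discharges `hMR` for those two classes, generically:
* §1 `decays_add_min` (two legs at their own rates ⇒ the sum at the min rate); `absMoment₂_hessKer'` =
  `ExpKernelCalculus.absMoment₂_hessKer` with the three rates matched by monotonicity.
* §2 **`absMoment₂_legCross`**: for decaying legs `A`, `B` and vertex∕table families `V`, `W` at the coarse bonds, `z ↦ legCross A B V W μ ν z` has absolutely summable second moments —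
  because `legCross A B V W = hessKer (A + B) V W − hessKer A V W` (`PackedKernelSplit.hessKer_add_leg`) and both terms are (5.10)-kernels.
* §3 **`absMoment₂_blockTerms'`**: `PackedKernelSplitBounds.absMoment₂_blockTerms` (leaf file, explicit (5.10) constants) with the three rates matched by monotonicity —
  for a decaying packed `K` and packed families `V`, `W` at their own positive rates, `z ↦ blockTerms K V W μ ν z` has absolutely summable second moments.
* §4 road instances over `NlegRoad m a` (mod `Spr (Ga (m+1) a)`, [B5] Prop. 1.2 ∧ (1.126)–(1.127) by name elsewhere): `absMoment₂_blockTerms_NlegRoad`, `absMoment₂_legCross_NlegRoad`.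

HONEST: [folklore] bookkeeping over `ExpKernelCalculus.absMoment₂_hessKer`, `PackedKernelSplit(Bounds)`, `TameKernelCalculus`, `RWeightedLegPack`; no `def`, nothing cited, 0 sorry; NO n-UNIFORM bound is
claimed (the constants are per `n` — the unit-class rows RK-SAND∕RK-BLK of the spec are NOT here); 0 rows discharged; (K) NOT closed; NOT D1, NOT `BetaPertH`, NOT continuum, NOT Clay.
HONEST DEPENDENCY: continuum YM on T⁴ ⇐ BetaPertH ∧ nine spine estimates (0/9 proved); BetaPertH ⇐ (D1) ∧ (D4) ∧ CAP+tail; G-an2-4 gates asym, D1 and NE2/3/4.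
-/

noncomputable section

open Finset
open scoped BigOperators
open Literature.MathematicalPhysics.QuantumFieldTheory.Balaban1983to89
open Literature.MathematicalPhysics.QuantumFieldTheory.Balaban1983to89.Beta
open B12Sec2to5 (l1 l1_nonneg)
open ExpKernelCalculus (Site MKer Decays BiLoc VertexFamily VertexFamily₂ comp tr tadpole bubble hessKer absMoment₂_hessKer)
open DecimatedMomentSummable (AbsMoment₂)
open StepDriftWitness (absMoment₂_sub_gen)
open OneStepResolventKernel (Fib)
open Summit.QuantumFields.BalabanUV.Beta.TameKernelCalculus (Spr Loc decays_of_le biLoc_of_le)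
open Summit.QuantumFields.BalabanUV.Beta.D1BFx.PackedKernelSplit (blk ffV ffW legCross blockTerms decays_blk biLoc_blk hessKer_eq_ff_add_blockTerms hessKer_add_leg)
open Summit.QuantumFields.BalabanUV.Beta.D1BFx.PackedKernelSplitBounds (vertexFamily_ffV vertexFamily₂_ffW absMoment₂_blockTerms)
open Summit.QuantumFields.BalabanUV.Beta.D1BFx.CoarseGramInverse (multM spr_multM)
open Summit.QuantumFields.BalabanUV.Beta.D1BFx.RWeightedLegPack (NlegK NlegRoad sandP spr_NlegK spr_NlegRoad spr_sandP spr_smul')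

namespace Summit.QuantumFields.BalabanUV.Beta.D1BFx.RestKernelAbsMoment

/-! ## §1 Bookkeeping -/

section Book

variable {D : ℕ} {F : Type*} [Fintype F]

omit [Fintype F] in
/-- [folklore] `Decays` of a sum of two legs decaying at their own rates: constant `|CA| + |CB|`, rate `min δA δB`. -/
theorem decays_add_min {A B : MKer D F} {CA CB δA δB : ℝ} (hA : Decays A CA δA) (hB : Decays B CB δB) :
    Decays (A + B) (|CA| + |CB|) (min δA δB) := by
  intro x y a b
  rw [Pi.add_apply, Pi.add_apply, Pi.add_apply, Pi.add_apply, add_mul]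
  exact (abs_add_le _ _).trans
    (add_le_add (decays_of_le hA (min_le_left _ _) x y a b) (decays_of_le hB (min_le_right _ _) x y a b))

/-- [folklore] `ExpKernelCalculus.absMoment₂_hessKer` with the three rates matched by monotonicity: a decaying leg (rate `δA > 0`), a first-order vertex family (rate `δv > 0`)
and a second-order family (rate `δw > 0`) at the coarse bonds of blocking `N ≥ 1` ⇒ every channel of `hessKer A V W` has absolutely summable second moments. -/
theorem absMoment₂_hessKer' {A : MKer D F} {V : Fin D → Site D → MKer D F} {W : Fin D → Site D → Fin D → Site D → MKer D F}
    {CA Cv Cw δA δv δw : ℝ} {N : ℕ} (hA : Decays A CA δA) (hδA : 0 < δA) (hV : VertexFamily V N Cv δv) (hδv : 0 < δv)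
    (hW : VertexFamily₂ W N Cw δw) (hδw : 0 < δw) (hN : 1 ≤ N) (μ ν : Fin D) : AbsMoment₂ (hessKer A V W μ ν) := by
  set δ : ℝ := min δA (min δv δw) with hδ
  have hδpos : 0 < δ := lt_min hδA (lt_min hδv hδw)
  have hA' : Decays A (|CA|) δ := decays_of_le hA (min_le_left _ _)
  have hV' : VertexFamily V N (|Cv|) δ := fun μ' y => biLoc_of_le (hV μ' y) ((min_le_right _ _).trans (min_le_left _ _))
  have hW' : VertexFamily₂ W N (|Cw|) δ := fun μ' y ν' y' => biLoc_of_le (hW μ' y ν' y') ((min_le_right _ _).trans (min_le_right _ _))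
  exact absMoment₂_hessKer hA' hV' hW' hδpos hN μ ν

end Book

/-! ## §2 The sandwich cross words -/

section Cross

variable {D : ℕ} {F : Type*} [Fintype F]

/-- [folklore] **«RK-ABS», CROSS WORDS**: for decaying legs `A`, `B` (positive rates) and vertex∕table families `V`, `W` at the coarse bonds (blocking `N ≥ 1`), every channel of the
cross-word kernel `z ↦ legCross A B V W μ ν z` (`½·tadpole B W − ½·(biBubble A V B V′ + biBubble B V A V′ + biBubble B V B V′)`) has absolutely summable second moments —
`legCross A B V W = hessKer (A + B) V W − hessKer A V W`. -/
theorem absMoment₂_legCross {A B : MKer D F} {V : Fin D → Site D → MKer D F} {W : Fin D → Site D → Fin D → Site D → MKer D F}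
    {CA CB Cv Cw δA δB δv δw : ℝ} {N : ℕ} (hA : Decays A CA δA) (hδA : 0 < δA) (hB : Decays B CB δB) (hδB : 0 < δB)
    (hV : VertexFamily V N Cv δv) (hδv : 0 < δv) (hW : VertexFamily₂ W N Cw δw) (hδw : 0 < δw) (hN : 1 ≤ N) (μ ν : Fin D) :
    AbsMoment₂ (fun z => legCross A B V W μ ν z) := by
  have hAB : Decays (A + B) (|CA| + |CB|) (min δA δB) := decays_add_min hA hB
  have hδAB : 0 < min δA δB := lt_min hδA hδB
  have h1 := absMoment₂_hessKer' hAB hδAB hV hδv hW hδw hN μ ν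
  have h2 := absMoment₂_hessKer' hA hδA hV hδv hW hδw hN μ ν
  have hSA : Spr A := ⟨CA, δA, hδA, hA⟩
  have hSB : Spr B := ⟨CB, δB, hδB, hB⟩
  have hLV : ∀ μ y, Loc (V μ y) := fun μ y => ⟨_, _, Cv, δv, hδv, hV μ y⟩
  have hLW : ∀ μ y ν y', Loc (W μ y ν y') := fun μ y ν y' => ⟨_, _, Cw, δw, hδw, hW μ y ν y'⟩
  have e : (fun z => legCross A B V W μ ν z) = fun z => hessKer (A + B) V W μ ν z - hessKer A V W μ ν z := by
    funext z
    rw [hessKer_add_leg hSA hSB hLV hLW μ ν z]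
    ring
  rw [e]
  exact absMoment₂_sub_gen h1 h2

end Cross

/-! ## §3 The block terms -/

section Block

variable {D : ℕ} {F : Type*} [Fintype F]

/-- [folklore] **«RK-ABS», BLOCK TERMS** (`PackedKernelSplitBounds.absMoment₂_blockTerms` with the rates matched): for a decaying packed kernel `K` (rate `δK > 0`) and packed
vertex∕table families `V`, `W` at the coarse bonds (rates `δv, δw > 0`, blocking `N ≥ 1`), every channel of the block-term kernel `z ↦ blockTerms K V W μ ν z` (the 3 tadpoles +
15 bi-bubbles with at least one fm∕mf∕mm leg) has absolutely summable second moments. -/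
theorem absMoment₂_blockTerms' {K : MKer D (F ⊕ F)} {V : Fin D → Site D → MKer D (F ⊕ F)} {W : Fin D → Site D → Fin D → Site D → MKer D (F ⊕ F)}
    {C Cv Cw δK δv δw : ℝ} {N : ℕ} (hK : Decays K C δK) (hδK : 0 < δK) (hV : VertexFamily V N Cv δv) (hδv : 0 < δv)
    (hW : VertexFamily₂ W N Cw δw) (hδw : 0 < δw) (hN : 1 ≤ N) (μ ν : Fin D) :
    AbsMoment₂ (fun z => blockTerms K V W μ ν z) := by
  set δ : ℝ := min δK (min δv δw) with hδ
  have hδpos : 0 < δ := lt_min hδK (lt_min hδv hδw)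
  have hK' : Decays K (|C|) δ := decays_of_le hK (min_le_left _ _)
  have hV' : VertexFamily V N (|Cv|) δ := fun μ' y => biLoc_of_le (hV μ' y) ((min_le_right _ _).trans (min_le_left _ _))
  have hW' : VertexFamily₂ W N (|Cw|) δ := fun μ' y ν' y' => biLoc_of_le (hW μ' y ν' y') ((min_le_right _ _).trans (min_le_right _ _))
  exact absMoment₂_blockTerms hK' hV' hW' hδpos hN μ ν

end Block

/-! ## §4 Road instances over the N-leg -/

section Road

variable (m : ℕ) {a : ℝ}

/-- [folklore] **BLOCK TERMS OVER THE ROAD's N-LEG** (mod `Spr (Ga (m+1) a)`): for packed families `V`, `W` at the coarse bonds of blocking `m + 1`,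
`AbsMoment₂ (fun z => blockTerms (NlegRoad m a) V W μ ν z)`. -/
theorem absMoment₂_blockTerms_NlegRoad (hGa : Spr (GluonLeg.Ga (m + 1) a))
    {V : Fin 4 → Site 4 → MKer 4 (Fib 3)} {W : Fin 4 → Site 4 → Fin 4 → Site 4 → MKer 4 (Fib 3)} {Cv Cw δv δw : ℝ}
    (hV : VertexFamily V (m + 1) Cv δv) (hδv : 0 < δv) (hW : VertexFamily₂ W (m + 1) Cw δw) (hδw : 0 < δw) (μ ν : Fin 4) :
    AbsMoment₂ (fun z => blockTerms (NlegRoad m a) V W μ ν z) := by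
  obtain ⟨C, δ, hδ, hK⟩ := spr_NlegRoad m a hGa
  exact absMoment₂_blockTerms' hK hδ hV hδv hW hδw (Nat.le_add_left 1 m) μ ν

/-- [folklore] **SANDWICH CROSS WORDS OVER THE ROAD's FINE LEG** (mod `Spr (Ga (m+1) a)`): for fine-fibre families `V`, `W` at the coarse bonds of blocking `m + 1`, the cross words of
the split leg `½•Ga + (−½)•sandwich_ff` (`NlegKHessSplit.hessKer_NlegRoad_split`) have `AbsMoment₂` in every channel. -/
theorem absMoment₂_legCross_NlegRoad (hGa : Spr (GluonLeg.Ga (m + 1) a))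
    {V : Fin 4 → Site 4 → MKer 4 (Fin 4)} {W : Fin 4 → Site 4 → Fin 4 → Site 4 → MKer 4 (Fin 4)} {Cv Cw δv δw : ℝ}
    (hV : VertexFamily V (m + 1) Cv δv) (hδv : 0 < δv) (hW : VertexFamily₂ W (m + 1) Cw δw) (hδw : 0 < δw) (μ ν : Fin 4) :
    AbsMoment₂ (fun z => legCross ((2 : ℝ)⁻¹ • GluonLeg.Ga (m + 1) a)
      ((-(2 : ℝ)⁻¹) • blk (sandP (m + 1) (GluonLeg.Ga (m + 1) a) (multM (m + 1) (2 * a / ((m + 1 : ℕ) : ℝ) ^ 8) 2)) true true) V W μ ν z) := by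
  obtain ⟨CA, δA, hδA, hA⟩ := spr_smul' (2 : ℝ)⁻¹ hGa
  obtain ⟨CB, δB, hδB, hB⟩ := spr_smul' (-(2 : ℝ)⁻¹)
    (PackedKernelSplit.spr_blk (spr_sandP (m + 1) hGa (spr_multM (m + 1) (2 * a / ((m + 1 : ℕ) : ℝ) ^ 8) 2)) true true)
  exact absMoment₂_legCross hA hδA hB hδB hV hδv hW hδw (Nat.le_add_left 1 m) μ ν

end Road

end Summit.QuantumFields.BalabanUV.Beta.D1BFx.RestKernelAbsMoment

end
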